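import Summits.AtomisticToContinuum.Crystallization.Theorems.FrustratedLawDichotomyStrainedPatchHomParamTransfer
import Summits.AtomisticToContinuum.Crystallization.Theorems.FrustratedLawDichotomyStrainedPatchHomEntryFitCentred

/-!
# ParamTransfer §6 — the U-COLLAR: robust fit packages are stable under SMALL RELATIVE PERTURBATIONS OF THE STRAIN `U`
# (the 9-dimensional collar: ξ-shift of NODE 90 §4 ∘ U-perturbation; `dilate` of §3 is the scalar case `U' = s • U`)

decomp-a2c hand-2 g41 — structural share for the crux `AperiodicFrustratedLawGap` (stmt-AtomisticToContinuum-27623; `(H) HomFloor`, hcp half),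
on top of lens-5's NODE 90 `…HomParamTransfer` (p854325).  There the thin robust certificate `HcpFitCoreRobust U ξ R η' dlo dhi ρ e₀` travels along
TWO families of the parameter `(U, ξ)`: the ξ-collar (`shift`, V-b) and the exact dilations `s • U` (`dilate`, V-c).  Every other direction of `U`
is served only by CONTAINMENT in the thin `U`-box (fat leaf #25 `uContained`, cone leaf #26 `uConeContained`), i.e. by the kit's interval arithmetic.

THE OBSERVATION.  Every vector the package measures is `U` applied to a FIXED reference vector: `nbrU U ξ k = U (nbr k + [hshift k] ξ)` (`nbrU_eq`),
`latPt U f b = U (Σ bᵢ fᵢ)`, `latPt U f b + U (hcpShift + ξ) = U (Σ bᵢ fᵢ + hcpShift + ξ)`.  Hence a second strain `U'` with the RELATIVE bound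
`‖U' v − U v‖ ≤ κ‖U v‖` (e.g. `U' = A ∘ U`, `‖A − 1‖ ≤ κ`; §3 derives it from an absolute bound `‖U' − U‖ ≤ κ₀` inside the window) moves every
measured vector `w` to one of norm in `[(1 − κ)‖w‖, (1 + κ)‖w‖]` at distance `≤ κ‖w‖` — MULTIPLICATIVELY, exactly like a dilation, so the far-field
clauses (which defeat an additive U-collar: `‖latPt U b‖` is large for `|b|∞ ≤ 7`) transform with NO loss beyond the package's own slacks:

* §1 the displacement lemmas (`nbrU_eq_apply`, `norm_nbrU_sub_le_rel`, `latPt`/B-site versions, two-sided norm bounds);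
* §2 ★★ `perturbU` — `h : HcpFitCoreRobust U ξ R η' dlo dhi ρ e₀`, `hrel : ∀ v, ‖U' v − U v‖ ≤ κ‖U v‖`, `0 ≤ κ`, `31/10·κ ≤ ρ` ⟹
  `HcpFitCoreRobust U' ξ R η' ((1 − κ)dlo) ((1 + κ)dhi) (ρ − 31/10·κ) (e₀ + 13/5·κ·dlo)` — a ROBUST package again (the remaining `ρ − 31/10 κ` serves
  the ξ-collar at `U'`); the constant `31/10` is forced by the A-site far clause (`13/10·c ≥ 26/10·dhi + 1/100 + 13/10·ρ` with `dhi + ρ ≤ 3/2`);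
* §2 ★★ `hcpLeafGoal_of_perturbU_collar` — … and then `shift` + the landed goodness theorem: the hcp leaf goal at every `(U', ξ')` with
  `‖U'(ξ' − ξ)‖ ≤ ρ − 31/10·κ`, window clauses of the ACTUAL pair only;
* §3 kit-facing: `rel_of_opNorm` (`‖U' − U‖ ≤ κ₀`, `‖U' − 1‖ ≤ 1/4`, `κ₀ < 3/4` ⟹ relative bound with `κ = κ₀/(3/4 − κ₀)`), the entry-box form via the
  tree's Frobenius lemma `norm_sub_le_sqrt_of_entries`, and ★ `hcpLeafGoal_of_uCollar` — the semantic soundness SHAPE of a future `uCollarLeaf`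
  (base set `B` of PAIRS `(U, ξ)` robustly certified; the cell's `(U', ξ')` within `κ₀` of some base `U` in operator norm and within the remaining
  ξ-collar): ONE thin certificate now serves a full 9-dimensional neighbourhood of its box, not only the 3 shuffle directions and the dilation ray.

The Boolean leaf (integer test: entrywise excess of the cell's `U`-box over the thin `U`-box ⟹ `κ₀` by Frobenius, clamp OPERATOR of `U'` into the
thin box as the base) is the next port; this file is the real side, kit-independent.  Pure triangle inequalities over landed definitions; 0 sorry;
standard axioms; no instances / notation.  `--supports stmt-AtomisticToContinuum-27623`.
-/

noncomputable section

namespace Summit.AtomisticToContinuum.Crystallization.Theorems.FrustratedLawDichotomyStrainedPatchHomParamTransferMul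

open scoped BigOperators RealInnerProductSpace
open Summit.AtomisticToContinuum.Crystallization.Theorems.ChargedEnergyGapNegative (E3)
open Summit.AtomisticToContinuum.Crystallization.Theorems.FrustratedLawDichotomyStrainedPatchHomSplit
open Summit.AtomisticToContinuum.Crystallization.Theorems.FrustratedLawDichotomyStrainedPatchHomEntryHcpFrame
open Summit.AtomisticToContinuum.Crystallization.Theorems.FrustratedLawDichotomyStrainedPatchHomEntryLeafHT (HcpLeafGoal)
open Summit.AtomisticToContinuum.Crystallization.Theorems.FrustratedLawDichotomyStrainedPatchHomParamTransfer
open Summit.AtomisticToContinuum.Crystallization.Theorems.FrustratedLawDichotomyStrainedPatchHomEntryFitCentred (norm_sub_le_sqrt_of_entries)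

/-! ## §1. Relative perturbation of the strain: every measured vector moves multiplicatively -/

section Displacement
variable {U U' : E3 →L[ℝ] E3} {κ : ℝ}

/-- `nbrU U ξ k` is `U` applied to the fixed reference vector `nbr k + [hshift k] ξ`. [formal bookkeeping over `nbrU_eq`] -/
theorem nbrU_eq_apply (U : E3 →L[ℝ] E3) (ξ : E3) (k : Fin 12) : nbrU U ξ k = U (nbr k + if hshift k then ξ else 0) := by
  rw [nbrU_eq]
  split_ifs <;> simp [map_add]

/-- Upper norm bound under a relative perturbation. [triangle inequality] -/
theorem norm_le_of_rel (hrel : ∀ v : E3, ‖U' v - U v‖ ≤ κ * ‖U v‖) (v : E3) : ‖U' v‖ ≤ (1 + κ) * ‖U v‖ := by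
  have h1 : ‖U' v‖ ≤ ‖U v‖ + ‖U' v - U v‖ := by
    have := norm_add_le (U v) (U' v - U v)
    rwa [add_sub_cancel] at this
  linarith [hrel v]

/-- Lower norm bound under a relative perturbation. [triangle inequality] -/
theorem le_norm_of_rel (hrel : ∀ v : E3, ‖U' v - U v‖ ≤ κ * ‖U v‖) (v : E3) : (1 - κ) * ‖U v‖ ≤ ‖U' v‖ := by
  have h1 : ‖U v‖ ≤ ‖U' v‖ + ‖U' v - U v‖ := by
    have := norm_sub_le (U' v) (U' v - U v)
    rwa [sub_sub_cancel] at this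
  linarith [hrel v]

/-- The deformed neighbours move by `≤ κ‖nbrU U ξ k‖`. [formal bookkeeping] -/
theorem norm_nbrU_sub_le_rel (hrel : ∀ v : E3, ‖U' v - U v‖ ≤ κ * ‖U v‖) (ξ : E3) (k : Fin 12) :
    ‖nbrU U' ξ k - nbrU U ξ k‖ ≤ κ * ‖nbrU U ξ k‖ := by
  rw [nbrU_eq_apply U', nbrU_eq_apply U]
  exact hrel _

/-- … so their norms lie in `[(1 − κ)‖·‖, (1 + κ)‖·‖]`. [formal bookkeeping] -/
theorem norm_nbrU_rel_bounds (hrel : ∀ v : E3, ‖U' v - U v‖ ≤ κ * ‖U v‖) (ξ : E3) (k : Fin 12) :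
    (1 - κ) * ‖nbrU U ξ k‖ ≤ ‖nbrU U' ξ k‖ ∧ ‖nbrU U' ξ k‖ ≤ (1 + κ) * ‖nbrU U ξ k‖ := by
  rw [nbrU_eq_apply U', nbrU_eq_apply U]
  exact ⟨le_norm_of_rel hrel _, norm_le_of_rel hrel _⟩

/-- The A-sublattice far points scale: `(1 − κ)‖latPt U f b‖ ≤ ‖latPt U' f b‖`. [formal bookkeeping] -/
theorem le_norm_latPt_rel (hrel : ∀ v : E3, ‖U' v - U v‖ ≤ κ * ‖U v‖) (f : Fin 3 → E3) (b : Fin 3 → ℤ) :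
    (1 - κ) * ‖latPt U f b‖ ≤ ‖latPt U' f b‖ :=
  le_norm_of_rel hrel _

/-- The B-sublattice far points scale: `(1 − κ)‖latPt U f b + U s‖ ≤ ‖latPt U' f b + U' s‖`. [formal bookkeeping] -/
theorem le_norm_latPt_add_rel (hrel : ∀ v : E3, ‖U' v - U v‖ ≤ κ * ‖U v‖) (f : Fin 3 → E3) (b : Fin 3 → ℤ) (s : E3) :
    (1 - κ) * ‖latPt U f b + U s‖ ≤ ‖latPt U' f b + U' s‖ := by
  have e1 : latPt U f b + U s = U ((∑ i : Fin 3, ((b i : ℤ) : ℝ) • f i) + s) := by simp only [latPt, map_add]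
  have e2 : latPt U' f b + U' s = U' ((∑ i : Fin 3, ((b i : ℤ) : ℝ) • f i) + s) := by simp only [latPt, map_add]
  rw [e1, e2]
  exact le_norm_of_rel hrel _

end Displacement

/-! ## §2. ★★ The robust package under a U-perturbation, and the 9-dimensional collar leaf goal -/

section Perturb
variable {U U' : E3 →L[ℝ] E3} {ξ ξ' : E3} {R : E3 →ₗᵢ[ℝ] E3} {η' dlo dhi ρ e₀ κ : ℝ}

/-- ★★ **U-PERTURBATION OF THE ROBUST PACKAGE**: a relative strain perturbation of size `κ` with `31/10·κ ≤ ρ` maps the robust package at `(U, ξ)`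
to a ROBUST package at `(U', ξ)` with payload `((1 − κ)dlo, (1 + κ)dhi, ρ − 31/10·κ, e₀ + 13/5·κ·dlo)`.  The `13/5·κ·dlo` is `2κ·(13/10 dlo)`: one
moved neighbour plus the minimal scale VALUE (which is `κ·max‖nbrU‖`-stable although the minimising index may jump); `31/10` is the A-site far
clause.  Generalises `dilate` (scalar `A`) to arbitrary near-identity left factors. [triangle inequalities] -/
theorem perturbU (h : HcpFitCoreRobust U ξ R η' dlo dhi ρ e₀) (hrel : ∀ v : E3, ‖U' v - U v‖ ≤ κ * ‖U v‖) (hκ0 : 0 ≤ κ)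
    (hκ : 31 / 10 * κ ≤ ρ) :
    HcpFitCoreRobust U' ξ R η' ((1 - κ) * dlo) ((1 + κ) * dhi) (ρ - 31 / 10 * κ) (e₀ + 13 / 5 * κ * dlo) := by
  -- payload facts
  have hρ0 := h.hρ0
  have hρ := h.hρ
  have hdhiρ := h.hdhi
  obtain ⟨k₁, hk₁⟩ := h.hhi
  have hdlodhi : dlo ≤ dhi := (h.hlo k₁).trans hk₁
  have hdlo0 : 0 < dlo := lt_of_le_of_lt hρ0 hρ
  have hdhi32 : dhi ≤ 3 / 2 := by linarith
  have hκ1 : κ < 1 := by nlinarith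
  have h1κ : 0 ≤ 1 - κ := by linarith
  -- per-site bounds
  have hbd := norm_nbrU_rel_bounds hrel ξ
  have hM : ∀ k, ‖nbrU U ξ k‖ ≤ 13 / 10 * dlo := fun k => by linarith [h.hcl k]
  have hup : ∀ k, ‖nbrU U' ξ k‖ ≤ ‖nbrU U ξ k‖ + κ * (13 / 10 * dlo) := fun k => by
    have := (hbd k).2
    have := mul_le_mul_of_nonneg_left (hM k) hκ0
    nlinarith [norm_nonneg (nbrU U ξ k)]
  have hdn : ∀ k, ‖nbrU U ξ k‖ - κ * (13 / 10 * dlo) ≤ ‖nbrU U' ξ k‖ := fun k => by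
    have := (hbd k).1
    have := mul_le_mul_of_nonneg_left (hM k) hκ0
    nlinarith [norm_nonneg (nbrU U ξ k)]
  refine ⟨h.hη0, h.hη, by linarith, ?_, ?_, fun k => ?_, ⟨k₁, ?_⟩, fun k k' hmin => ?_, ?_, fun k => ?_,
    fun b hb hb0 hl => ?_, fun b hb hl => ?_⟩
  · -- `ρ' < dlo'`
    nlinarith
  · -- `dhi' + ρ' ≤ 3/2`
    nlinarith
  · -- `dlo' ≤ ‖nbrU U' ξ k‖`
    have := (hbd k).1
    nlinarith [h.hlo k]
  · -- `‖nbrU U' ξ k₁‖ ≤ dhi'`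
    have := (hbd k₁).2
    nlinarith
  · -- the fit residual at an exact minimiser `k'` of the PERTURBED configuration
    obtain ⟨k₀, -, hk₀⟩ := Finset.exists_min_image Finset.univ (fun j : Fin 12 => ‖nbrU U ξ j‖) Finset.univ_nonempty
    have hmin₀ : ∀ j, ‖nbrU U ξ k₀‖ ≤ ‖nbrU U ξ j‖ := fun j => hk₀ j (Finset.mem_univ j)
    have hf := h.hfit k k₀ hmin₀
    -- the minimal scale VALUE moves by at most `κ·(13/10 dlo)`
    have hval : |‖nbrU U' ξ k'‖ - ‖nbrU U ξ k₀‖| ≤ κ * (13 / 10 * dlo) := by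
      rw [abs_le]
      constructor
      · -- lower: ‖n'_{k'}‖ ≥ (1-κ)‖n_{k'}‖ ≥ (1-κ)‖n_{k₀}‖ ≥ ‖n_{k₀}‖ − κ M
        have h1 := (hbd k').1
        have h2 := mul_le_mul_of_nonneg_left (hmin₀ k') h1κ
        have h3 := mul_le_mul_of_nonneg_left (hM k₀) hκ0
        nlinarith
      · -- upper: ‖n'_{k'}‖ ≤ ‖n'_{k₀}‖ ≤ (1+κ)‖n_{k₀}‖
        have h1 := hmin k₀
        have h2 := hup k₀
        linarith
    have hR : ‖R (nbr k)‖ = 1 := by rw [LinearIsometry.norm_map, norm_nbr]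
    have hdec : nbrU U' ξ k - ‖nbrU U' ξ k'‖ • R (nbr k) =
        (nbrU U ξ k - ‖nbrU U ξ k₀‖ • R (nbr k)) + (nbrU U' ξ k - nbrU U ξ k) - (‖nbrU U' ξ k'‖ - ‖nbrU U ξ k₀‖) • R (nbr k) := by
      rw [sub_smul]; abel
    rw [hdec]
    refine (norm_sub_le _ _).trans ?_
    have h1 := norm_add_le (nbrU U ξ k - ‖nbrU U ξ k₀‖ • R (nbr k)) (nbrU U' ξ k - nbrU U ξ k)
    have h2 : ‖(‖nbrU U' ξ k'‖ - ‖nbrU U ξ k₀‖) • R (nbr k)‖ ≤ κ * (13 / 10 * dlo) := by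
      rw [norm_smul, hR, mul_one, Real.norm_eq_abs]; exact hval
    have h3 : ‖nbrU U' ξ k - nbrU U ξ k‖ ≤ κ * (13 / 10 * dlo) :=
      (norm_nbrU_sub_le_rel hrel ξ k).trans (mul_le_mul_of_nonneg_left (hM k) hκ0)
    nlinarith
  · -- the budget `e₀' + 2ρ' ≤ η'(dlo' − ρ')`
    have he := h.he
    have hη0 := h.hη0
    have h1 : 0 ≤ η' * κ * (31 / 10 - dlo) := by
      have : 0 ≤ 31 / 10 - dlo := by linarith
      positivity
    nlinarith
  · -- the clean inequality
    have h1 := hup k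
    have h2 := h.hcl k
    have h3 : κ * (13 / 10 * dlo) ≤ κ * (39 / 20) := mul_le_mul_of_nonneg_left (by linarith) hκ0
    nlinarith
  · -- A-site far clause: multiplicative
    have hF := h.hfarA b hb hb0 hl
    have hL := le_norm_latPt_rel hrel hexFrame b
    have h1 : (1 - κ) * (13 / 10 * dhi + 1 / 100 + 13 / 10 * ρ) ≤ (1 - κ) * ‖latPt U hexFrame b‖ := mul_le_mul_of_nonneg_left hF h1κ
    have h2 : κ * (26 / 10 * dhi + 1 / 100 + 13 / 10 * ρ) ≤ κ * (391 / 100) := by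
      refine mul_le_mul_of_nonneg_left ?_ hκ0
      linarith
    nlinarith
  · -- B-site far clause: multiplicative
    have hF := h.hfarB b hb hl
    have hL := le_norm_latPt_add_rel hrel hexFrame b (hcpShift + ξ)
    have h1 : (1 - κ) * (13 / 10 * dhi + 1 / 100 + 23 / 10 * ρ) ≤ (1 - κ) * ‖latPt U hexFrame b + U (hcpShift + ξ)‖ :=
      mul_le_mul_of_nonneg_left hF h1κ
    have h2 : κ * (26 / 10 * dhi + 1 / 100 + 23 / 10 * ρ) ≤ κ * (391 / 100) := by
      refine mul_le_mul_of_nonneg_left ?_ hκ0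
      linarith
    nlinarith

/-- ★★ **THE 9-DIMENSIONAL COLLAR**: a robust package at `(U, ξ)`, a strain `U'` with `‖U' v − U v‖ ≤ κ‖U v‖` (`31/10·κ ≤ ρ`) and a shuffle `ξ'` with
`‖U'(ξ' − ξ)‖ ≤ ρ − 31/10·κ` give the hcp leaf goal at `(U', ξ')` (window clauses of the actual pair), every level.
[`perturbU` ∘ `HcpFitCoreRobust.shift` ∘ the landed goodness theorem] -/
theorem hcpLeafGoal_of_perturbU_collar (h : HcpFitCoreRobust U ξ R η' dlo dhi ρ e₀) (hrel : ∀ v : E3, ‖U' v - U v‖ ≤ κ * ‖U v‖)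
    (hκ0 : 0 ≤ κ) (hκ : 31 / 10 * κ ≤ ρ) (hρ' : ‖U' (ξ' - ξ)‖ ≤ ρ - 31 / 10 * κ) (hU' : ‖U' - 1‖ ≤ 1 / 4) (hξ' : ‖ξ'‖ ≤ 1 / 2) (μ : ℤ) :
    HcpLeafGoal μ U' ξ' :=
  ((perturbU h hrel hκ0 hκ).shift hρ').hcpLeafGoal hU' hξ' μ

end Perturb

/-! ## §3. Kit-facing forms: the relative bound from an operator-norm (entry-box) bound inside the window; the U-collar leaf shape -/

section Tests
variable {U U' : E3 →L[ℝ] E3}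

/-- ★ Inside the window `‖U' − 1‖ ≤ 1/4`, an ABSOLUTE bound `‖U' − U‖ ≤ κ₀ < 3/4` gives the relative bound with `κ = κ₀/(3/4 − κ₀)`
(`‖U v‖ ≥ ‖U' v‖ − κ₀‖v‖ ≥ (3/4 − κ₀)‖v‖`). [triangle inequalities] -/
theorem rel_of_opNorm {κ₀ : ℝ} (hU' : ‖U' - 1‖ ≤ 1 / 4) (hκ₀ : ‖U' - U‖ ≤ κ₀) (hlt : κ₀ < 3 / 4) (v : E3) :
    ‖U' v - U v‖ ≤ κ₀ / (3 / 4 - κ₀) * ‖U v‖ := by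
  have hκ00 : 0 ≤ κ₀ := (norm_nonneg _).trans hκ₀
  have hd : 0 < 3 / 4 - κ₀ := by linarith
  have h1 : ‖U' v - U v‖ ≤ κ₀ * ‖v‖ := by
    have e : U' v - U v = (U' - U) v := rfl
    rw [e]
    exact (ContinuousLinearMap.le_opNorm _ _).trans (mul_le_mul_of_nonneg_right hκ₀ (norm_nonneg _))
  have h2 : ‖v‖ - ‖(U' - 1) v‖ ≤ ‖U' v‖ := by
    have e : U' v = v + (U' - 1) v := by simp
    have h' : ‖v‖ ≤ ‖v + (U' - 1) v‖ + ‖(U' - 1) v‖ := by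
      have := norm_sub_le (v + (U' - 1) v) ((U' - 1) v)
      rwa [add_sub_cancel_right] at this
    rw [e]; linarith
  have h3 : ‖(U' - 1) v‖ ≤ 1 / 4 * ‖v‖ := (ContinuousLinearMap.le_opNorm _ _).trans (mul_le_mul_of_nonneg_right hU' (norm_nonneg _))
  have h4 : ‖U' v‖ ≤ ‖U v‖ + ‖U' v - U v‖ := by
    have := norm_add_le (U v) (U' v - U v)
    rwa [add_sub_cancel] at this
  have h5 : (3 / 4 - κ₀) * ‖v‖ ≤ ‖U v‖ := by nlinarith [norm_nonneg v]
  rw [div_mul_eq_mul_div, le_div_iff₀ hd]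
  calc ‖U' v - U v‖ * (3 / 4 - κ₀) ≤ κ₀ * ‖v‖ * (3 / 4 - κ₀) := mul_le_mul_of_nonneg_right h1 hd.le
    _ = κ₀ * ((3 / 4 - κ₀) * ‖v‖) := by ring
    _ ≤ κ₀ * ‖U v‖ := mul_le_mul_of_nonneg_left h5 hκ00

/-- The operator-norm bound from the ENTRY BOX (tree Frobenius lemma): entrywise `|(U' e_b)_a − (U e_b)_a| ≤ ε_ab` ⟹ `‖U' − U‖ ≤ √(Σ ε²)`.
[formal bookkeeping: `…EntryFitCentred.norm_sub_le_sqrt_of_entries`] -/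
theorem opNorm_sub_le_of_entries {ε : Fin 3 → Fin 3 → ℝ}
    (h : ∀ a b : Fin 3, |(U' (EuclideanSpace.single b (1 : ℝ))) a - (U (EuclideanSpace.single b (1 : ℝ))) a| ≤ ε a b) :
    ‖U' - U‖ ≤ Real.sqrt (∑ a : Fin 3, ∑ b : Fin 3, (ε a b) ^ 2) :=
  norm_sub_le_sqrt_of_entries h

/-- ★ **THE U-COLLAR LEAF SHAPE** (semantic soundness of a future `uCollarLeaf`): a base set `B` of parameter PAIRS each carrying a robust package
with collar `ρ`; a cell pair `(U', ξ')` in the window with SOME base pair `(U, ξ) ∈ B` at operator distance `≤ κ₀` (`κ₀ < 3/4`,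
`κ := κ₀/(3/4 − κ₀)`, `31/10·κ ≤ ρ`) and shuffle distance `‖U'(ξ' − ξ)‖ ≤ ρ − 31/10·κ` meets the hcp leaf goal at every level.  The three
memberships are the leaf's integer tests (entry boxes via `opNorm_sub_le_of_entries`, the clamp of #25/#26 for `ξ`). [folklore] -/
theorem hcpLeafGoal_of_uCollar {B : Set ((E3 →L[ℝ] E3) × E3)} {ρ κ₀ : ℝ}
    (hcert : ∀ p ∈ B, ∃ (R : E3 →ₗᵢ[ℝ] E3) (η' dlo dhi e₀ : ℝ), HcpFitCoreRobust p.1 p.2 R η' dlo dhi ρ e₀)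
    (hlt : κ₀ < 3 / 4) (hκ : 31 / 10 * (κ₀ / (3 / 4 - κ₀)) ≤ ρ) {U' : E3 →L[ℝ] E3} {ξ' : E3}
    (hnear : ∃ p ∈ B, ‖U' - p.1‖ ≤ κ₀ ∧ ‖U' (ξ' - p.2)‖ ≤ ρ - 31 / 10 * (κ₀ / (3 / 4 - κ₀)))
    (hU' : ‖U' - 1‖ ≤ 1 / 4) (hξ' : ‖ξ'‖ ≤ 1 / 2) (μ : ℤ) : HcpLeafGoal μ U' ξ' := by
  obtain ⟨⟨U, ξ⟩, hpB, hUU, hξξ⟩ := hnear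
  obtain ⟨R, η', dlo, dhi, e₀, h⟩ := hcert _ hpB
  have hκ00 : 0 ≤ κ₀ := (norm_nonneg _).trans hUU
  have hκ0 : 0 ≤ κ₀ / (3 / 4 - κ₀) := div_nonneg hκ00 (by linarith)
  exact hcpLeafGoal_of_perturbU_collar h (rel_of_opNorm hU' hUU hlt) hκ0 hκ hξξ hU' hξ' μ

/-- SANITY (the ξ-collar of NODE 90 is the case `U' = U`, `κ₀ = 0`): [formal bookkeeping] -/
example {U : E3 →L[ℝ] E3} {ξ ξ' : E3} {R : E3 →ₗᵢ[ℝ] E3} {η' dlo dhi ρ e₀ : ℝ} (h : HcpFitCoreRobust U ξ R η' dlo dhi ρ e₀)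
    (hρ' : ‖U (ξ' - ξ)‖ ≤ ρ) (hU : ‖U - 1‖ ≤ 1 / 4) (hξ' : ‖ξ'‖ ≤ 1 / 2) (μ : ℤ) : HcpLeafGoal μ U ξ' :=
  hcpLeafGoal_of_perturbU_collar (κ := 0) h (fun v => by simp) le_rfl (by linarith [h.hρ0]) (by simpa using hρ') hU hξ' μ

end Tests

end Summit.AtomisticToContinuum.Crystallization.Theorems.FrustratedLawDichotomyStrainedPatchHomParamTransferMul

end
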